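import Summits.Ventures.PercRepro.ProfilePointedCircuitClassesInOutTenB

/-!
# PercRepro — THE IN–OUT INEQUALITY AT `n = 10`, III: THE UNITS' DEGREES AND THE RESOURCE RELATION (p5, gen 40;
`proofs/P5-GM1.md` §59)

With the demands `𝒟` (bi-independent `4`-sets `W ∋ e`), the units `𝒰` (bi-independent `5`-sets `W' ∌ e`), the
neighbour relation `W ∩ W' = ∅` and the DEFICIENT demands `𝒯 := {W ∈ 𝒟 : W has ≤ 3 neighbours}` (exactly the
demands with `κ(W) = 3`, part I), the count of neighbour pairs gives `4·#𝒟 − #𝒯 ≤ Σ_W s(W) = Σ_{W'} p(W')`, where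
`p(W') ≤ 4` always (a disjoint demand is `(E ∖ W') − z`, `z ≠ e`) and `p(W') ≤ 2` when the complement of `W'` contains a
series pair `{p, p'}` (`ρ(E ∖ {p, p'}) = 5`: the point `z` must lie in the pair).  The RESOURCE RELATION
`W ℛ W'` :⟺ `#(W ∩ W') = 1`, `#((E ∖ W') ∖ W) = 2`, `ρ(E ∖ ((E ∖ W') ∖ W)) = 5` links every deficient demand to its
three units of part II, and a unit to at most five demands (the series pair `E ∖ cl W'` is unique, so `W` is
determined by `W ∩ W'`).  Hence `3·#𝒯 ≤ 5·#𝒰_ℛ`, `Σ_{W'} p(W') + 2·#𝒰_ℛ ≤ 4·#𝒰`, and `#𝒟 ≤ #𝒰`.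

THIS FILE (part III): `card_filter_disjoint_demands_le_four` (`p(W') ≤ 4`), `card_filter_disjoint_demands_le_two`
(`p(W') ≤ 2` with a series pair), `series_pair_unique`, `card_filter_resource_le_five`, `three_le_card_filter_resource`.
Part IV (`…InOutTenD`): the double counting and **`inCount_four_le_outCount_five_of_ten`**.
-/

open scoped Matroid

namespace PercRepro.Cogirth

open Finset ThmH Skew Shadow Profile

variable {α : Type} [DecidableEq α] {N : Matroid α} [N.Finite] {e : α}

section InOutTenC

/-- A demand disjoint from the unit `W'` is `(E ∖ W') − z` for a point `z ≠ e`; so `p(W') ≤ 4`. -/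
theorem card_filter_disjoint_demands_le_four (hn : (gr N).card = 10) (he : e ∈ gr N) {W' : Finset α}
    (hW' : W' ∈ (biIndepSets N 5).filter (fun W' => e ∉ W')) :
    (((biIndepSets N 4).filter (fun W => e ∈ W)).filter (fun W => W ∩ W' = ∅)).card ≤ 4 := by
  rw [mem_filter, mem_biIndepSets] at hW'
  obtain ⟨⟨hW'g, hW'5, _, _⟩, heW'⟩ := hW'
  have hVcard : (gr N \ W').card = 5 := by rw [card_sdiff_of_subset hW'g, hn, hW'5]
  have heV : e ∈ gr N \ W' := mem_sdiff.2 ⟨he, heW'⟩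
  have htarget : (((gr N \ W').erase e).powersetCard 1).card = 4 := by
    rw [card_powersetCard, card_erase_of_mem heV, hVcard, Nat.choose_one_right]
  refine (card_le_card_of_injOn (fun W => (gr N \ W') \ W) ?_ ?_).trans htarget.le
  · intro W hW
    rw [mem_coe, mem_filter, mem_filter, mem_biIndepSets] at hW
    obtain ⟨⟨⟨hWg, hW4, _, _⟩, heW⟩, hWW'⟩ := hW
    have hWV : W ⊆ gr N \ W' :=
      subset_sdiff.2 ⟨hWg, disjoint_iff_inter_eq_empty.2 hWW'⟩
    rw [mem_coe, mem_powersetCard]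
    refine ⟨?_, by rw [card_sdiff_of_subset hWV, hVcard, hW4]⟩
    intro g hg
    beta_reduce at hg
    rw [mem_sdiff] at hg
    exact mem_erase.2 ⟨fun h => hg.2 (h ▸ heW), hg.1⟩
  · intro W₁ hW₁ W₂ hW₂ h
    rw [mem_coe, mem_filter, mem_filter, mem_biIndepSets] at hW₁ hW₂
    have h₁ : W₁ ⊆ gr N \ W' :=
      subset_sdiff.2 ⟨hW₁.1.1.1, disjoint_iff_inter_eq_empty.2 hW₁.2⟩
    have h₂ : W₂ ⊆ gr N \ W' :=
      subset_sdiff.2 ⟨hW₂.1.1.1, disjoint_iff_inter_eq_empty.2 hW₂.2⟩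
    simp only at h
    rw [← Finset.sdiff_sdiff_eq_self h₁, ← Finset.sdiff_sdiff_eq_self h₂, h]

/-- With a series pair `π ⊆ E ∖ W'` (`#π = 2`, `ρ(E ∖ π) = 5`) in its complement, the unit `W'` has `p(W') ≤ 2`:
a disjoint demand `W = (E ∖ W') − z` has `E ∖ W = W' + z` of rank `6`, which forces `z ∈ π`. -/
theorem card_filter_disjoint_demands_le_two (hn : (gr N).card = 10) {W' : Finset α}
    (hW' : W' ∈ (biIndepSets N 5).filter (fun W' => e ∉ W')) {π : Finset α} (hπ : π ⊆ gr N \ W')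
    (hπ2 : π.card = 2) (hπrk : rk N (gr N \ π) = 5) :
    (((biIndepSets N 4).filter (fun W => e ∈ W)).filter (fun W => W ∩ W' = ∅)).card ≤ 2 := by
  rw [mem_filter, mem_biIndepSets] at hW'
  obtain ⟨⟨hW'g, hW'5, _, _⟩, heW'⟩ := hW'
  have hVcard : (gr N \ W').card = 5 := by rw [card_sdiff_of_subset hW'g, hn, hW'5]
  have htarget : (π.powersetCard 1).card = 2 := by
    rw [card_powersetCard, hπ2, Nat.choose_one_right]
  refine (card_le_card_of_injOn (fun W => (gr N \ W') \ W) ?_ ?_).trans htarget.le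
  · intro W hW
    rw [mem_coe, mem_filter, mem_filter, mem_biIndepSets] at hW
    obtain ⟨⟨⟨hWg, hW4, _, hWc⟩, heW⟩, hWW'⟩ := hW
    have hWV : W ⊆ gr N \ W' :=
      subset_sdiff.2 ⟨hWg, disjoint_iff_inter_eq_empty.2 hWW'⟩
    have hcard1 : ((gr N \ W') \ W).card = 1 := by rw [card_sdiff_of_subset hWV, hVcard, hW4]
    rw [mem_coe, mem_powersetCard]
    refine ⟨?_, hcard1⟩
    intro g hg
    beta_reduce at hg
    by_contra hgπ
    have hgV : g ∈ gr N \ W' := (mem_sdiff.1 hg).1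
    have hgW : g ∉ W := (mem_sdiff.1 hg).2
    -- `E ∖ W = W' + g`
    have hsing : (gr N \ W') \ W = {g} := by
      rw [card_eq_one] at hcard1
      obtain ⟨a, ha⟩ := hcard1
      rw [ha] at hg ⊢
      rw [mem_singleton] at hg
      rw [hg]
    have hcompl : gr N \ W = insert g W' := by
      ext x
      rw [mem_sdiff, mem_insert]
      constructor
      · rintro ⟨hx, hxW⟩
        by_cases hxW' : x ∈ W'
        · exact Or.inr hxW'
        · have : x ∈ (gr N \ W') \ W := mem_sdiff.2 ⟨mem_sdiff.2 ⟨hx, hxW'⟩, hxW⟩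
          rw [hsing, mem_singleton] at this
          exact Or.inl this
      · rintro (rfl | hx)
        · exact ⟨(mem_sdiff.1 hgV).1, hgW⟩
        · exact ⟨hW'g hx, fun h => (mem_sdiff.1 (hWV h)).2 hx⟩
    -- `W' + g ⊆ E ∖ π` has rank `≤ 5`
    have hsub : insert g W' ⊆ gr N \ π := by
      intro x hx
      rw [mem_insert] at hx
      rw [mem_sdiff]
      rcases hx with rfl | hx
      · exact ⟨(mem_sdiff.1 hgV).1, hgπ⟩
      · exact ⟨hW'g hx, fun h => (mem_sdiff.1 (hπ h)).2 hx⟩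
    have h1 := rk_mono' (M := N) hsub
    rw [← hcompl, hWc, card_sdiff_of_subset hWg, hn, hW4] at h1
    omega
  · intro W₁ hW₁ W₂ hW₂ h
    rw [mem_coe, mem_filter, mem_filter, mem_biIndepSets] at hW₁ hW₂
    have h₁ : W₁ ⊆ gr N \ W' :=
      subset_sdiff.2 ⟨hW₁.1.1.1, disjoint_iff_inter_eq_empty.2 hW₁.2⟩
    have h₂ : W₂ ⊆ gr N \ W' :=
      subset_sdiff.2 ⟨hW₂.1.1.1, disjoint_iff_inter_eq_empty.2 hW₂.2⟩
    simp only at h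
    rw [← Finset.sdiff_sdiff_eq_self h₁, ← Finset.sdiff_sdiff_eq_self h₂, h]

/-- **The series pair of a unit is unique**: two pairs `π₁, π₂ ⊆ E ∖ W'` with `ρ(E ∖ π_i) = 5` coincide, since
`E ∖ π₁` and `E ∖ π₂` both contain the rank-`5` set `W'`, so by submodularity `ρ(E ∖ (π₁ ∩ π₂)) ≤ 5`, while
`E ∖ (π₁ ∩ π₂)` is `E` or `E − x` when `π₁ ≠ π₂` (coloop-free: rank `6`). -/
theorem series_pair_unique (hR : rk N (gr N) = 6) (hcf : ∀ x ∈ gr N, rk N ((gr N).erase x) = 6)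
    {W' : Finset α} (hW'g : W' ⊆ gr N) (hW'rk : rk N W' = 5) {π₁ π₂ : Finset α} (h₁ : π₁ ⊆ gr N \ W')
    (h₂ : π₂ ⊆ gr N \ W') (hc₁ : π₁.card = 2) (hc₂ : π₂.card = 2) (hr₁ : rk N (gr N \ π₁) = 5)
    (hr₂ : rk N (gr N \ π₂) = 5) : π₁ = π₂ := by
  by_contra hne
  have hsub : W' ⊆ (gr N \ π₁) ∩ (gr N \ π₂) := by
    intro x hx
    rw [mem_inter, mem_sdiff, mem_sdiff]
    exact ⟨⟨hW'g hx, fun h => (mem_sdiff.1 (h₁ h)).2 hx⟩, ⟨hW'g hx, fun h => (mem_sdiff.1 (h₂ h)).2 hx⟩⟩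
  have hlow := rk_mono' (M := N) hsub
  have hsm := rk_inter_add_rk_union_le' (M := N) (gr N \ π₁) (gr N \ π₂)
  rw [← sdiff_inter_distrib_right] at hsm
  have hup : rk N (gr N \ (π₁ ∩ π₂)) ≤ 5 := by omega
  -- `π₁ ∩ π₂` has at most one element
  have hle1 : (π₁ ∩ π₂).card ≤ 1 := by
    by_contra hcon
    have h2 : π₁.card ≤ (π₁ ∩ π₂).card := by omega
    have heq : π₁ ∩ π₂ = π₁ := eq_of_subset_of_card_le inter_subset_left h2
    have h12 : π₁ ⊆ π₂ := by rw [← heq]; exact inter_subset_right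
    exact hne (eq_of_subset_of_card_le h12 (by omega))
  rcases Nat.le_one_iff_eq_zero_or_eq_one.1 hle1 with h0 | h1
  · rw [card_eq_zero] at h0
    rw [h0, sdiff_empty, hR] at hup
    omega
  · rw [card_eq_one] at h1
    obtain ⟨x, hx⟩ := h1
    have hxg : x ∈ gr N := by
      have : x ∈ π₁ ∩ π₂ := by rw [hx]; exact mem_singleton_self x
      exact (mem_sdiff.1 (h₁ (mem_inter.1 this).1)).1
    rw [hx, sdiff_singleton_eq_erase, hcf x hxg] at hup
    omega

/-- **A unit is a resource of at most five demands**: for `W ℛ W'` the pair `(E ∖ W') ∖ W` is the unique series pair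
of `W'`, so `W = ((E ∖ W') ∖ π) ∪ (W ∩ W')` is determined by the singleton `W ∩ W' ⊆ W'`. -/
theorem card_filter_resource_le_five (hR : rk N (gr N) = 6) (hcf : ∀ x ∈ gr N, rk N ((gr N).erase x) = 6)
    {W' : Finset α} (hW' : W' ∈ (biIndepSets N 5).filter (fun W' => e ∉ W')) :
    (((biIndepSets N 4).filter (fun W => e ∈ W)).filter (fun W => (W ∩ W').card = 1 ∧
      ((gr N \ W') \ W).card = 2 ∧ rk N (gr N \ ((gr N \ W') \ W)) = 5)).card ≤ 5 := by
  rw [mem_filter, mem_biIndepSets] at hW'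
  obtain ⟨⟨hW'g, hW'5, hW'rk, _⟩, _⟩ := hW'
  rw [hW'5] at hW'rk
  have htarget : (W'.powersetCard 1).card = 5 := by
    rw [card_powersetCard, hW'5, Nat.choose_one_right]
  refine (card_le_card_of_injOn (fun W => W ∩ W') ?_ ?_).trans htarget.le
  · intro W hW
    rw [mem_coe, mem_filter] at hW
    rw [mem_coe, mem_powersetCard]
    exact ⟨inter_subset_right, hW.2.1⟩
  · intro W₁ hW₁ W₂ hW₂ h
    rw [mem_coe, mem_filter, mem_filter, mem_biIndepSets] at hW₁ hW₂
    obtain ⟨⟨⟨hW₁g, _, _, _⟩, _⟩, _, hc₁, hr₁⟩ := hW₁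
    obtain ⟨⟨⟨hW₂g, _, _, _⟩, _⟩, _, hc₂, hr₂⟩ := hW₂
    simp only at h
    have hπ := series_pair_unique hR hcf hW'g hW'rk (π₁ := (gr N \ W') \ W₁) (π₂ := (gr N \ W') \ W₂)
      sdiff_subset sdiff_subset hc₁ hc₂ hr₁ hr₂
    -- `W = ((E ∖ W') ∖ ((E ∖ W') ∖ W)) ∪ (W ∩ W')`
    have hrec : ∀ W : Finset α, W ⊆ gr N → W = ((gr N \ W') \ ((gr N \ W') \ W)) ∪ (W ∩ W') := by
      intro W hWg
      rw [sdiff_sdiff_self_left]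
      ext x
      rw [mem_union, mem_inter, mem_inter, mem_sdiff]
      constructor
      · intro hx
        by_cases hxW' : x ∈ W'
        · exact Or.inr ⟨hx, hxW'⟩
        · exact Or.inl ⟨⟨hWg hx, hxW'⟩, hx⟩
      · rintro (⟨_, hx⟩ | ⟨hx, _⟩) <;> exact hx
    rw [hrec W₁ hW₁g, hrec W₂ hW₂g, hπ, h]

/-- **A deficient demand has at least three resource units** (part II's `unit_of_deficient`, one per pair of the
series class `P`). -/
theorem three_le_card_filter_resource (hn : (gr N).card = 10)
    (hcf : ∀ x ∈ gr N, rk N ((gr N).erase x) = 6)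
    (hcf' : ∀ x ∈ (gr N).erase e, rk N (((gr N).erase e).erase x) = 6) {W : Finset α}
    (hW : W ∈ (biIndepSets N 4).filter (fun W => e ∈ W))
    (hs : (((biIndepSets N 5).filter (fun W' => e ∉ W')).filter (fun W' => W ∩ W' = ∅)).card ≤ 3) :
    3 ≤ (((biIndepSets N 5).filter (fun W' => e ∉ W')).filter (fun W' => (W ∩ W').card = 1 ∧
      ((gr N \ W') \ W).card = 2 ∧ rk N (gr N \ ((gr N \ W') \ W)) = 5)).card := by
  rw [mem_filter] at hW
  obtain ⟨hW4, heW⟩ := hW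
  have hW4' := hW4
  rw [mem_biIndepSets] at hW4'
  obtain ⟨hWg, hWcard, hWrk, hWc⟩ := hW4'
  have hBcard : (gr N \ W).card = 6 := by rw [card_sdiff_of_subset hWg, hn, hWcard]
  -- `P` has exactly three points
  have hPle := (card_filter_rk_insert_eq_five_le_card_disjoint_units hn hW4 heW).trans hs
  have hKle := card_filter_rk_insert_eq_four_le_three hn hcf hW4
  have hsplit := card_filter_add_card_filter_not (s := gr N \ W) (p := fun z => rk N (insert z W) = 5)
  have hKeq : (gr N \ W).filter (fun z => ¬ rk N (insert z W) = 5) =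
      (gr N \ W).filter (fun z => rk N (insert z W) = 4) := by
    apply filter_congr
    intro z hz
    have h1 := rk_insert_le_add_one (mem_sdiff.1 hz).1 hWg
    have h2 := rk_mono' (M := N) (subset_insert z W)
    rw [hWcard] at hWrk
    omega
  rw [hKeq, hBcard] at hsplit
  have hP : ((gr N \ W).filter (fun z => rk N (insert z W) = 5)).card = 3 := by omega
  set P := (gr N \ W).filter (fun z => rk N (insert z W) = 5) with hPdef
  have hPB : P ⊆ gr N \ W := filter_subset _ _
  -- a first point `p₀ ∈ P` and the point `w`
  obtain ⟨p₀, hp₀⟩ := card_pos.1 (show 0 < P.card by omega)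
  obtain ⟨w, hwW, hwe, hwp₀⟩ := exists_rk_insert_erase_eq_six_of_deficient hn hcf' hW4 heW (hPB hp₀)
  have hBrk : rk N (gr N \ W) = 6 := by rw [hWc, hBcard]
  have hwB : w ∉ gr N \ W := fun h => (mem_sdiff.1 h).2 hwW
  have hwall : ∀ p ∈ P, rk N (insert w ((gr N \ W).erase p)) = 6 := by
    intro p hp
    by_cases hpp₀ : p = p₀
    · rw [hpp₀]; exact hwp₀
    · exact rk_insert_erase_eq_of_series sdiff_subset hBcard hBrk (hPB hp₀) (hPB hp)
        (fun h => hpp₀ h.symm) (rk_sdiff_pair_eq_five_of_deficient hcf hW4 hP hp₀ hp (fun h => hpp₀ h.symm))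
        (hcf p (mem_sdiff.1 (hPB hp)).1) (hWg hwW) hwB hwp₀
  -- the three pairs of `P` give three resource units
  have htarget : (P.powersetCard 2).card = 3 := by
    rw [card_powersetCard, hP]
    decide
  refine htarget.ge.trans (card_le_card_of_injOn (fun π => insert w ((gr N \ W) \ π)) ?_ ?_)
  · intro π hπ
    rw [mem_coe, mem_powersetCard] at hπ
    obtain ⟨hπP, hπ2⟩ := hπ
    obtain ⟨p, p', hpp', rfl⟩ := card_eq_two.1 hπ2
    have hp : p ∈ P := hπP (mem_insert_self p {p'})
    have hp' : p' ∈ P := hπP (mem_insert_of_mem (mem_singleton_self p'))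
    obtain ⟨hmem, hinter, hsd, hser⟩ := unit_of_deficient hn hcf hW4 heW hP hp hp' hpp' hwW hwe (hwall p hp)
    rw [mem_coe, mem_filter]
    refine ⟨hmem, ?_, ?_, ?_⟩
    · rw [hinter, card_singleton]
    · rw [hsd, card_pair hpp']
    · rw [hsd]; exact hser
  · intro π₁ hπ₁ π₂ hπ₂ h
    rw [mem_coe, mem_powersetCard] at hπ₁ hπ₂
    simp only at h
    obtain ⟨p, p', hpp', rfl⟩ := card_eq_two.1 hπ₁.2
    obtain ⟨q, q', hqq', rfl⟩ := card_eq_two.1 hπ₂.2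
    have hp : p ∈ P := hπ₁.1 (mem_insert_self p {p'})
    have hp' : p' ∈ P := hπ₁.1 (mem_insert_of_mem (mem_singleton_self p'))
    have hq : q ∈ P := hπ₂.1 (mem_insert_self q {q'})
    have hq' : q' ∈ P := hπ₂.1 (mem_insert_of_mem (mem_singleton_self q'))
    have hsd₁ := (unit_of_deficient hn hcf hW4 heW hP hp hp' hpp' hwW hwe (hwall p hp)).2.2.1
    have hsd₂ := (unit_of_deficient hn hcf hW4 heW hP hq hq' hqq' hwW hwe (hwall q hq)).2.2.1
    rw [← hsd₁, ← hsd₂, h]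

end InOutTenC

end PercRepro.Cogirth
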